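import Summits.NavierStokesRegularity.NavierStokesRegularity.Theorems.ExtremiserTransienceNearExtremalTransienceExtremiserLiouvilleConstantSpeedSlideTail
import Summits.NavierStokesRegularity.NavierStokesRegularity.Theorems.ExtremiserTransienceNearExtremalTransienceExtremiserLiouvilleConstantSpeedSlidePalinstrophyLimit
import Summits.NavierStokesRegularity.NavierStokesRegularity.Theorems.ExtremiserTransienceNearExtremalTransienceExtremiserLiouvilleConstantSpeedSlideEnstrophy
import HarnessLib

/-!
# Crux `ExtremiserTransience.NearExtremalTransience` (stmt-NavierStokesRegularity-21883), line `extremiser_liouville`,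
# stub K1b — THE PLANAR ENSTROPHY IDENTITY `∫γω₂² = ∫γ|∇_hV_h|² − ∫γ(∂₂V₂)²` (record §15, first IBP of R6a-int: the `W′`-line is coercive)

`--supports stmt-NavierStokesRegularity-21883` (helper).  Author: prover seat `ns-el-k1b` (g9).

The enstrophy variation along the slide (`slideEnstrophyLaw_jet`, p721994; the `W′`-line of `slideInequality_layer`) contains
`½∫g′ω₂²`.  For a divergence-free field, `ω₂² = |∇_hV_h|² − (div_h V_h)² + 2 det ∇_hV_h`, `div_hV_h = −∂₂V₂`, and the null
Lagrangian `det ∇_hV_h = ∂₀V₀∂₁V₁ − ∂₁V₀∂₀V₁ = D(V₀)[A]`, `A = (∂₁V₁, −∂₀V₁, 0)`, `div A = 0`, integrates to zero against any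
weight `w(x₂)` (horizontal rule, …SlideTail):
* `det_hgrad_eq_fderiv_apply`, `divergence_detField_eq_zero` : the pointwise facts;
* `integral_axialWeight_det_hgrad_eq_zero` : `∫w(x₂)(∂₀V₀∂₁V₁ − ∂₁V₀∂₀V₁) = 0`;
* `integral_axialWeight_curl_two_sq_eq` : **`∫w(x₂)ω₂² = ∫w(x₂)|∇_hV_h|² − ∫w(x₂)(∂₂V₂)²`** (`w ∈ C¹` bounded, `w = 0` off a
  square-integrable slab, `D¹V ∈ L²`).  Inserted in the `W′`-line this gives the manifestly coercive form
  `A₁ = ∫g′[½|∇_hV_h|² + (3/2)|∂₂V_h|² + (3/2)(∂₂V₂)²] + (V₂-small terms)` of record §0 (INEQ).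

WHAT THIS IS NOT: K1b is NOT proved; nothing here proves NS regularity. [folklore]
-/

noncomputable section

open Set Filter Topology MeasureTheory Metric Function InnerProductSpace
open scoped ENNReal NNReal Topology InnerProductSpace RealInnerProductSpace ContDiff
open Literature.Analysis.FluidPDE Literature.Analysis

namespace Summit.NavierStokesRegularity.NavierStokesRegularity.Theorems

-- the problem directory repeats the summit name (`NavierStokesRegularity/NavierStokesRegularity`)
set_option linter.dupNamespace false

namespace ExtremiserLiouville

open DepletionLadder.KStar

variable {V : EuclideanSpace ℝ (Fin 3) → EuclideanSpace ℝ (Fin 3)} {w : ℝ → ℝ}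

/-! ## 1. Pointwise facts -/

/-- `ω₂ = ∂₀V₁ − ∂₁V₀`. [folklore] -/
theorem curl_apply_two (V : EuclideanSpace ℝ (Fin 3) → EuclideanSpace ℝ (Fin 3)) (x : EuclideanSpace ℝ (Fin 3)) :
    curl V x 2 = fderiv ℝ V x (EuclideanSpace.single (0 : Fin 3) (1 : ℝ)) 1 - fderiv ℝ V x (EuclideanSpace.single (1 : Fin 3) (1 : ℝ)) 0 := by
  simp [curl]

/-- The null Lagrangian as a directional derivative: `∂₀V₀∂₁V₁ − ∂₁V₀∂₀V₁ = D(V₀)(x)[A(x)]`, `A = (∂₁V₁, −∂₀V₁, 0)`. [folklore] -/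
theorem det_hgrad_eq_fderiv_apply (hVd : Differentiable ℝ V) (x : EuclideanSpace ℝ (Fin 3)) :
    fderiv ℝ V x (EuclideanSpace.single (0 : Fin 3) (1 : ℝ)) 0 * fderiv ℝ V x (EuclideanSpace.single (1 : Fin 3) (1 : ℝ)) 1 -
        fderiv ℝ V x (EuclideanSpace.single (1 : Fin 3) (1 : ℝ)) 0 * fderiv ℝ V x (EuclideanSpace.single (0 : Fin 3) (1 : ℝ)) 1 =
      fderiv ℝ (fun y => V y 0) x
        ((fderiv ℝ V x (EuclideanSpace.single (1 : Fin 3) (1 : ℝ)) 1) • EuclideanSpace.single (0 : Fin 3) (1 : ℝ) -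
          (fderiv ℝ V x (EuclideanSpace.single (0 : Fin 3) (1 : ℝ)) 1) • EuclideanSpace.single (1 : Fin 3) (1 : ℝ)) := by
  rw [fderiv_coord_apply (hVd x) 0, map_sub, map_smul, map_smul]
  simp only [PiLp.sub_apply, PiLp.smul_apply, smul_eq_mul]
  ring

/-- `div (∂₁V₁, −∂₀V₁, 0) = 0` (mixed partials). [folklore] -/
theorem divergence_detField_eq_zero (hV : ContDiff ℝ 2 V) (x : EuclideanSpace ℝ (Fin 3)) :
    VectorCalculus.divergence (fun y : EuclideanSpace ℝ (Fin 3) =>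
        (fderiv ℝ V y (EuclideanSpace.single (1 : Fin 3) (1 : ℝ)) 1) • EuclideanSpace.single (0 : Fin 3) (1 : ℝ) -
          (fderiv ℝ V y (EuclideanSpace.single (0 : Fin 3) (1 : ℝ)) 1) • EuclideanSpace.single (1 : Fin 3) (1 : ℝ)) x = 0 := by
  set e₀ : EuclideanSpace ℝ (Fin 3) := EuclideanSpace.single (0 : Fin 3) (1 : ℝ) with he₀
  set e₁ : EuclideanSpace ℝ (Fin 3) := EuclideanSpace.single (1 : Fin 3) (1 : ℝ) with he₁
  have hD : ∀ v : EuclideanSpace ℝ (Fin 3), Differentiable ℝ fun y => fderiv ℝ V y v := fun v =>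
    ((hV.fderiv_right (m := 1) (by norm_num)).differentiable one_ne_zero).clm_apply (differentiable_const v)
  have hDi : ∀ (v : EuclideanSpace ℝ (Fin 3)) (i : Fin 3), Differentiable ℝ fun y => fderiv ℝ V y v i := fun v i =>
    (EuclideanSpace.proj i : EuclideanSpace ℝ (Fin 3) →L[ℝ] ℝ).differentiable.comp (hD v)
  have ha : Differentiable ℝ fun y => (fderiv ℝ V y e₁ 1) • e₀ := (hDi e₁ 1).smul_const e₀
  have hb : Differentiable ℝ fun y => (fderiv ℝ V y e₀ 1) • e₁ := (hDi e₀ 1).smul_const e₁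
  rw [divergence_eq_sum_three, fderiv_fun_sub (ha x) (hb x), fderiv_smul_const (hDi e₁ 1 x), fderiv_smul_const (hDi e₀ 1 x)]
  -- mixed partials `∂₀(∂₁V₁) = ∂₁(∂₀V₁)` componentwise
  have hM : fderiv ℝ (fun y => fderiv ℝ V y e₁ 1) x e₀ = fderiv ℝ (fun y => fderiv ℝ V y e₀ 1) x e₁ := by
    rw [fderiv_coord_apply (hD e₁ x) 1, fderiv_coord_apply (hD e₀ x) 1, fderiv_fderiv_apply_comm_vec hV x e₁ e₀]
  simp [ContinuousLinearMap.smulRight_apply, he₀, he₁] at hM ⊢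
  rw [← he₀, ← he₁] at hM ⊢
  simp [hM]

/-! ## 2. The null Lagrangian integrates to zero against axial weights -/

/-- **`∫w(x₂)(∂₀V₀∂₁V₁ − ∂₁V₀∂₀V₁) = 0`** for `w ∈ C¹` bounded and vanishing off a square-integrable slab, `D¹V ∈ L²`
(horizontal rule with `f = V₀`, `A = (∂₁V₁, −∂₀V₁, 0)`, `div A = 0`). [folklore] -/
theorem integral_axialWeight_det_hgrad_eq_zero (hV : ContDiff ℝ ∞ V) (hw : ContDiff ℝ 1 w) {K T : ℝ}
    (hwK : ∀ s, |w s| ≤ K) (hwT : ∀ s, T < |s| → w s = 0)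
    (h1 : ∫⁻ x, ‖iteratedFDeriv ℝ 1 V x‖ₑ ^ 2 < ⊤)
    (hslab : Integrable (fun x => {x : EuclideanSpace ℝ (Fin 3) | |x 2| ≤ T}.indicator (fun x => ‖V x‖ ^ 2) x) volume) :
    (∫ x, w (x 2) * (fderiv ℝ V x (EuclideanSpace.single (0 : Fin 3) (1 : ℝ)) 0 * fderiv ℝ V x (EuclideanSpace.single (1 : Fin 3) (1 : ℝ)) 1 -
        fderiv ℝ V x (EuclideanSpace.single (1 : Fin 3) (1 : ℝ)) 0 * fderiv ℝ V x (EuclideanSpace.single (0 : Fin 3) (1 : ℝ)) 1)) = 0 := by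
  set e₀ : EuclideanSpace ℝ (Fin 3) := EuclideanSpace.single (0 : Fin 3) (1 : ℝ) with he₀
  set e₁ : EuclideanSpace ℝ (Fin 3) := EuclideanSpace.single (1 : Fin 3) (1 : ℝ) with he₁
  set SL : Set (EuclideanSpace ℝ (Fin 3)) := {x | |x 2| ≤ T} with hSL
  have hK0 : 0 ≤ K := (abs_nonneg _).trans (hwK 0)
  have hVd : Differentiable ℝ V := hV.differentiable (by simp)
  have hV2 : ContDiff ℝ 2 V := hV.of_le (WithTop.coe_le_coe.mpr le_top)
  have cV : Continuous V := hV.continuous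
  have cDV : Continuous (fderiv ℝ V) := hV.continuous_fderiv (by simp)
  have cw : Continuous fun x : EuclideanSpace ℝ (Fin 3) => w (x 2) := hw.continuous.comp (PiLp.continuous_apply 2 _ (2 : Fin 3))
  have hD1 : Integrable (fun x => ‖fderiv ℝ V x‖ ^ 2) (volume : Measure (EuclideanSpace ℝ (Fin 3))) := by
    have h := integrable_sq_norm_of_lintegral (hV.continuous_iteratedFDeriv (WithTop.coe_le_coe.mpr le_top)) h1
    refine h.congr (Eventually.of_forall fun x => ?_)
    dsimp only
    rw [← norm_iteratedFDeriv_fderiv, norm_iteratedFDeriv_zero]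
  -- the field `A` and the scalar `f = V₀`
  have hDcd : ∀ v : EuclideanSpace ℝ (Fin 3), ContDiff ℝ ∞ fun y => fderiv ℝ V y v := fun v =>
    (hV.fderiv_right (m := ∞) (by exact_mod_cast le_rfl)).clm_apply contDiff_const
  have hDi : ∀ (v : EuclideanSpace ℝ (Fin 3)) (i : Fin 3), ContDiff ℝ ∞ fun y => fderiv ℝ V y v i := fun v i =>
    (EuclideanSpace.proj i : EuclideanSpace ℝ (Fin 3) →L[ℝ] ℝ).contDiff.comp (hDcd v)
  have hA : ContDiff ℝ 1 fun y : EuclideanSpace ℝ (Fin 3) => (fderiv ℝ V y e₁ 1) • e₀ - (fderiv ℝ V y e₀ 1) • e₁ :=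
    (((hDi e₁ 1).smul contDiff_const).sub ((hDi e₀ 1).smul contDiff_const)).of_le (WithTop.coe_le_coe.mpr le_top)
  have hA2 : ∀ y : EuclideanSpace ℝ (Fin 3), ((fderiv ℝ V y e₁ 1) • e₀ - (fderiv ℝ V y e₀ 1) • e₁) 2 = 0 := fun y => by
    simp [he₀, he₁]
  have hf : ContDiff ℝ 1 fun y : EuclideanSpace ℝ (Fin 3) => V y 0 :=
    ((EuclideanSpace.proj (0 : Fin 3) : EuclideanSpace ℝ (Fin 3) →L[ℝ] ℝ).contDiff.comp hV).of_le (WithTop.coe_le_coe.mpr le_top)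
  -- pointwise sizes
  have nA : ∀ y, ‖(fderiv ℝ V y e₁ 1) • e₀ - (fderiv ℝ V y e₀ 1) • e₁‖ ≤ 2 * ‖fderiv ℝ V y‖ := by
    intro y
    have n0 : ‖e₀‖ = 1 := by rw [he₀, PiLp.norm_single, norm_one]
    have n1 : ‖e₁‖ = 1 := by rw [he₁, PiLp.norm_single, norm_one]
    have b1 : |fderiv ℝ V y e₁ 1| ≤ ‖fderiv ℝ V y‖ :=
      (abs_apply_le_norm _ 1).trans (((fderiv ℝ V y).le_opNorm e₁).trans (by rw [n1, mul_one]))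
    have b0 : |fderiv ℝ V y e₀ 1| ≤ ‖fderiv ℝ V y‖ :=
      (abs_apply_le_norm _ 1).trans (((fderiv ℝ V y).le_opNorm e₀).trans (by rw [n0, mul_one]))
    refine (norm_sub_le _ _).trans ?_
    rw [norm_smul, norm_smul, n0, n1, mul_one, mul_one, Real.norm_eq_abs, Real.norm_eq_abs]
    linarith
  have nf : ∀ y, |V y 0| ≤ ‖V y‖ := fun y => abs_apply_le_norm _ 0
  have hwslab : ∀ x, |w (x 2)| * ‖V x‖ ^ 2 ≤ K * SL.indicator (fun x => ‖V x‖ ^ 2) x := by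
    intro x
    by_cases hx : x ∈ SL
    · rw [Set.indicator_of_mem hx]; exact mul_le_mul_of_nonneg_right (hwK _) (sq_nonneg _)
    · rw [hwT _ (not_le.1 hx), abs_zero, zero_mul, Set.indicator_of_notMem hx, mul_zero]
  -- (i0) `(w V₀) • A` is integrable
  have i0 : Integrable (fun x => (w (x 2) * V x 0) • ((fderiv ℝ V x e₁ 1) • e₀ - (fderiv ℝ V x e₀ 1) • e₁)) volume := by
    refine ((hslab.const_mul K).add (hD1.const_mul K)).mono' ((cw.mul ((PiLp.continuous_apply 2 _ (0 : Fin 3)).comp cV)).smul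
      (hA.continuous)).aestronglyMeasurable (Eventually.of_forall fun x => ?_)
    rw [norm_smul, norm_mul, Real.norm_eq_abs, Real.norm_eq_abs]
    simp only [Pi.add_apply]
    have h2 : |w (x 2)| * |V x 0| * ‖(fderiv ℝ V x e₁ 1) • e₀ - (fderiv ℝ V x e₀ 1) • e₁‖ ≤ |w (x 2)| * (‖V x‖ * (2 * ‖fderiv ℝ V x‖)) := by
      rw [mul_assoc]; exact mul_le_mul_of_nonneg_left (mul_le_mul (nf x) (nA x) (norm_nonneg _) (norm_nonneg _)) (abs_nonneg _)
    refine h2.trans ?_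
    have h3 : ‖V x‖ * (2 * ‖fderiv ℝ V x‖) ≤ ‖V x‖ ^ 2 + ‖fderiv ℝ V x‖ ^ 2 := by nlinarith [sq_nonneg (‖V x‖ - ‖fderiv ℝ V x‖)]
    calc |w (x 2)| * (‖V x‖ * (2 * ‖fderiv ℝ V x‖)) ≤ |w (x 2)| * (‖V x‖ ^ 2 + ‖fderiv ℝ V x‖ ^ 2) :=
          mul_le_mul_of_nonneg_left h3 (abs_nonneg _)
      _ = |w (x 2)| * ‖V x‖ ^ 2 + |w (x 2)| * ‖fderiv ℝ V x‖ ^ 2 := by ring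
      _ ≤ K * SL.indicator (fun x => ‖V x‖ ^ 2) x + K * ‖fderiv ℝ V x‖ ^ 2 :=
          add_le_add (hwslab x) (mul_le_mul_of_nonneg_right (hwK _) (sq_nonneg _))
  -- (i1) `w · D(V₀)[A]` is integrable
  have i1 : Integrable (fun x => w (x 2) * fderiv ℝ (fun y => V y 0) x ((fderiv ℝ V x e₁ 1) • e₀ - (fderiv ℝ V x e₀ 1) • e₁)) volume := by
    have hpt : ∀ x, w (x 2) * fderiv ℝ (fun y => V y 0) x ((fderiv ℝ V x e₁ 1) • e₀ - (fderiv ℝ V x e₀ 1) • e₁) =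
        w (x 2) * (fderiv ℝ V x e₀ 0 * fderiv ℝ V x e₁ 1 - fderiv ℝ V x e₁ 0 * fderiv ℝ V x e₀ 1) := fun x => by
      rw [← det_hgrad_eq_fderiv_apply hVd x]
    simp_rw [hpt]
    have cij : ∀ (v : EuclideanSpace ℝ (Fin 3)) (i : Fin 3), Continuous fun x => fderiv ℝ V x v i := fun v i => (hDi v i).continuous
    refine (hD1.const_mul (K * 2)).mono' ((cw.mul (((cij e₀ 0).mul (cij e₁ 1)).sub ((cij e₁ 0).mul (cij e₀ 1)))).aestronglyMeasurable)
      (Eventually.of_forall fun x => ?_)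
    rw [Real.norm_eq_abs, abs_mul]
    have b : ∀ (v : EuclideanSpace ℝ (Fin 3)) (i : Fin 3), ‖v‖ = 1 → |fderiv ℝ V x v i| ≤ ‖fderiv ℝ V x‖ := fun v i hv =>
      (abs_apply_le_norm _ i).trans (((fderiv ℝ V x).le_opNorm v).trans (by rw [hv, mul_one]))
    have n0 : ‖e₀‖ = 1 := by rw [he₀, PiLp.norm_single, norm_one]
    have n1 : ‖e₁‖ = 1 := by rw [he₁, PiLp.norm_single, norm_one]
    have hdet : |fderiv ℝ V x e₀ 0 * fderiv ℝ V x e₁ 1 - fderiv ℝ V x e₁ 0 * fderiv ℝ V x e₀ 1| ≤ 2 * ‖fderiv ℝ V x‖ ^ 2 := by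
      refine (abs_sub _ _).trans ?_
      rw [abs_mul, abs_mul]
      nlinarith [b e₀ 0 n0, b e₁ 1 n1, b e₁ 0 n1, b e₀ 1 n0, abs_nonneg (fderiv ℝ V x e₀ 0), abs_nonneg (fderiv ℝ V x e₁ 0),
        abs_nonneg (fderiv ℝ V x e₁ 1), abs_nonneg (fderiv ℝ V x e₀ 1)]
    calc |w (x 2)| * |fderiv ℝ V x e₀ 0 * fderiv ℝ V x e₁ 1 - fderiv ℝ V x e₁ 0 * fderiv ℝ V x e₀ 1| ≤ K * (2 * ‖fderiv ℝ V x‖ ^ 2) :=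
          mul_le_mul (hwK _) hdet (abs_nonneg _) hK0
      _ = K * 2 * ‖fderiv ℝ V x‖ ^ 2 := by ring
  -- (i2) the divergence term vanishes identically
  have hdiv0 : ∀ x, VectorCalculus.divergence (fun y : EuclideanSpace ℝ (Fin 3) => (fderiv ℝ V y e₁ 1) • e₀ - (fderiv ℝ V y e₀ 1) • e₁) x = 0 :=
    fun x => divergence_detField_eq_zero hV2 x
  have i2 : Integrable (fun x => w (x 2) * V x 0 *
      VectorCalculus.divergence (fun y : EuclideanSpace ℝ (Fin 3) => (fderiv ℝ V y e₁ 1) • e₀ - (fderiv ℝ V y e₀ 1) • e₁) x) volume := by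
    simp only [hdiv0, mul_zero]; exact integrable_zero _ _ _
  have key := integral_axialWeight_fderiv_apply_horizontal_eq hA hA2 hf hw i0 i1 i2
  simp only [hdiv0, mul_zero, integral_zero, neg_zero] at key
  rw [← key]
  refine integral_congr_ae (Eventually.of_forall fun x => ?_)
  dsimp only
  rw [← det_hgrad_eq_fderiv_apply hVd x]

/-- **The planar enstrophy identity**: `∫w(x₂)ω₂² = ∫w(x₂)(|∂₀V₀|² + |∂₁V₀|² + |∂₀V₁|² + |∂₁V₁|²) − ∫w(x₂)(∂₂V₂)²` for a
divergence-free `V` (`w ∈ C¹` bounded, `w = 0` off a square-integrable slab, `D¹V ∈ L²`). [folklore] -/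
theorem integral_axialWeight_curl_two_sq_eq (hV : ContDiff ℝ ∞ V) (hdiv : VectorCalculus.IsDivFree V) (hw : ContDiff ℝ 1 w) {K T : ℝ}
    (hwK : ∀ s, |w s| ≤ K) (hwT : ∀ s, T < |s| → w s = 0)
    (h1 : ∫⁻ x, ‖iteratedFDeriv ℝ 1 V x‖ₑ ^ 2 < ⊤)
    (hslab : Integrable (fun x => {x : EuclideanSpace ℝ (Fin 3) | |x 2| ≤ T}.indicator (fun x => ‖V x‖ ^ 2) x) volume) :
    (∫ x, w (x 2) * curl V x 2 ^ 2) =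
      (∫ x, w (x 2) * (fderiv ℝ V x (EuclideanSpace.single (0 : Fin 3) (1 : ℝ)) 0 ^ 2 + fderiv ℝ V x (EuclideanSpace.single (1 : Fin 3) (1 : ℝ)) 0 ^ 2 +
          fderiv ℝ V x (EuclideanSpace.single (0 : Fin 3) (1 : ℝ)) 1 ^ 2 + fderiv ℝ V x (EuclideanSpace.single (1 : Fin 3) (1 : ℝ)) 1 ^ 2)) -
        ∫ x, w (x 2) * fderiv ℝ V x (EuclideanSpace.single (2 : Fin 3) (1 : ℝ)) 2 ^ 2 := by
  have hK0 : 0 ≤ K := (abs_nonneg _).trans (hwK 0)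
  have cw : Continuous fun x : EuclideanSpace ℝ (Fin 3) => w (x 2) := hw.continuous.comp (PiLp.continuous_apply 2 _ (2 : Fin 3))
  have hDi : ∀ (v : EuclideanSpace ℝ (Fin 3)) (i : Fin 3), Continuous fun y => fderiv ℝ V y v i := fun v i =>
    ((EuclideanSpace.proj i : EuclideanSpace ℝ (Fin 3) →L[ℝ] ℝ).contDiff.comp
      ((hV.fderiv_right (m := ∞) (by exact_mod_cast le_rfl)).clm_apply contDiff_const)).continuous
  have hD1 : Integrable (fun x => ‖fderiv ℝ V x‖ ^ 2) (volume : Measure (EuclideanSpace ℝ (Fin 3))) := by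
    have h := integrable_sq_norm_of_lintegral (hV.continuous_iteratedFDeriv (WithTop.coe_le_coe.mpr le_top)) h1
    refine h.congr (Eventually.of_forall fun x => ?_)
    dsimp only
    rw [← norm_iteratedFDeriv_fderiv, norm_iteratedFDeriv_zero]
  have nrm : ∀ j : Fin 3, ‖EuclideanSpace.single j (1 : ℝ)‖ = 1 := fun j => by rw [PiLp.norm_single, norm_one]
  have bb : ∀ (x : EuclideanSpace ℝ (Fin 3)) (j i : Fin 3), |fderiv ℝ V x (EuclideanSpace.single j (1 : ℝ)) i| ≤ ‖fderiv ℝ V x‖ :=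
    fun x j i => (abs_apply_le_norm _ i).trans (((fderiv ℝ V x).le_opNorm _).trans (by rw [nrm, mul_one]))
  -- integrability of the weighted squares
  have iw : ∀ (j i : Fin 3), Integrable (fun x => w (x 2) * fderiv ℝ V x (EuclideanSpace.single j (1 : ℝ)) i ^ 2) volume := by
    intro j i
    refine (hD1.const_mul K).mono' ((cw.mul ((hDi _ i).pow 2)).aestronglyMeasurable) (Eventually.of_forall fun x => ?_)
    rw [Real.norm_eq_abs, abs_mul, abs_of_nonneg (sq_nonneg (fderiv ℝ V x (EuclideanSpace.single j (1 : ℝ)) i))]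
    refine mul_le_mul (hwK _) ?_ (sq_nonneg _) hK0
    rw [← sq_abs]; exact pow_le_pow_left₀ (abs_nonneg _) (bb x j i) 2
  have idet := integral_axialWeight_det_hgrad_eq_zero hV hw hwK hwT h1 hslab
  -- div-free: `∂₀V₀ + ∂₁V₁ + ∂₂V₂ = 0`
  have hdz : ∀ x, fderiv ℝ V x (EuclideanSpace.single (0 : Fin 3) (1 : ℝ)) 0 + fderiv ℝ V x (EuclideanSpace.single (1 : Fin 3) (1 : ℝ)) 1 + fderiv ℝ V x (EuclideanSpace.single (2 : Fin 3) (1 : ℝ)) 2 = 0 := fun x => by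
    have h := hdiv x; rwa [divergence_eq_sum_three] at h
  -- pointwise: `w ω₂² = w|∇_hV_h|² − w(∂₂V₂)² + 2w·det`
  have hpt : ∀ x, w (x 2) * curl V x 2 ^ 2 =
      w (x 2) * (fderiv ℝ V x (EuclideanSpace.single (0 : Fin 3) (1 : ℝ)) 0 ^ 2 + fderiv ℝ V x (EuclideanSpace.single (1 : Fin 3) (1 : ℝ)) 0 ^ 2 + fderiv ℝ V x (EuclideanSpace.single (0 : Fin 3) (1 : ℝ)) 1 ^ 2 + fderiv ℝ V x (EuclideanSpace.single (1 : Fin 3) (1 : ℝ)) 1 ^ 2) -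
        w (x 2) * fderiv ℝ V x (EuclideanSpace.single (2 : Fin 3) (1 : ℝ)) 2 ^ 2 +
        2 * (w (x 2) * (fderiv ℝ V x (EuclideanSpace.single (0 : Fin 3) (1 : ℝ)) 0 * fderiv ℝ V x (EuclideanSpace.single (1 : Fin 3) (1 : ℝ)) 1 - fderiv ℝ V x (EuclideanSpace.single (1 : Fin 3) (1 : ℝ)) 0 * fderiv ℝ V x (EuclideanSpace.single (0 : Fin 3) (1 : ℝ)) 1)) := by
    intro x
    rw [curl_apply_two]
    have h2 : fderiv ℝ V x (EuclideanSpace.single (2 : Fin 3) (1 : ℝ)) 2 = -(fderiv ℝ V x (EuclideanSpace.single (0 : Fin 3) (1 : ℝ)) 0 + fderiv ℝ V x (EuclideanSpace.single (1 : Fin 3) (1 : ℝ)) 1) := by linarith [hdz x]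
    rw [h2]; ring
  have isum : Integrable (fun x => w (x 2) * (fderiv ℝ V x (EuclideanSpace.single (0 : Fin 3) (1 : ℝ)) 0 ^ 2 + fderiv ℝ V x (EuclideanSpace.single (1 : Fin 3) (1 : ℝ)) 0 ^ 2 +
      fderiv ℝ V x (EuclideanSpace.single (0 : Fin 3) (1 : ℝ)) 1 ^ 2 + fderiv ℝ V x (EuclideanSpace.single (1 : Fin 3) (1 : ℝ)) 1 ^ 2)) volume := by
    have := (((iw 0 0).add (iw 1 0)).add (iw 0 1)).add (iw 1 1)
    refine this.congr (Eventually.of_forall fun x => ?_)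
    simp only [Pi.add_apply]; ring
  have i22 := iw 2 2
  have iAB : Integrable (fun x => w (x 2) * (fderiv ℝ V x (EuclideanSpace.single (0 : Fin 3) (1 : ℝ)) 0 ^ 2 + fderiv ℝ V x (EuclideanSpace.single (1 : Fin 3) (1 : ℝ)) 0 ^ 2 +
      fderiv ℝ V x (EuclideanSpace.single (0 : Fin 3) (1 : ℝ)) 1 ^ 2 + fderiv ℝ V x (EuclideanSpace.single (1 : Fin 3) (1 : ℝ)) 1 ^ 2) - w (x 2) * fderiv ℝ V x (EuclideanSpace.single (2 : Fin 3) (1 : ℝ)) 2 ^ 2) volume := isum.sub i22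
  have idetI : Integrable (fun x => 2 * (w (x 2) * (fderiv ℝ V x (EuclideanSpace.single (0 : Fin 3) (1 : ℝ)) 0 * fderiv ℝ V x (EuclideanSpace.single (1 : Fin 3) (1 : ℝ)) 1 -
      fderiv ℝ V x (EuclideanSpace.single (1 : Fin 3) (1 : ℝ)) 0 * fderiv ℝ V x (EuclideanSpace.single (0 : Fin 3) (1 : ℝ)) 1))) volume := by
    have cdet : Continuous fun x => w (x 2) * (fderiv ℝ V x (EuclideanSpace.single (0 : Fin 3) (1 : ℝ)) 0 * fderiv ℝ V x (EuclideanSpace.single (1 : Fin 3) (1 : ℝ)) 1 -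
        fderiv ℝ V x (EuclideanSpace.single (1 : Fin 3) (1 : ℝ)) 0 * fderiv ℝ V x (EuclideanSpace.single (0 : Fin 3) (1 : ℝ)) 1) :=
      cw.mul (((hDi _ 0).mul (hDi _ 1)).sub ((hDi _ 0).mul (hDi _ 1)))
    refine ((hD1.const_mul (2 * (K * 2))).mono' ((continuous_const.mul cdet).aestronglyMeasurable) (Eventually.of_forall fun x => ?_))
    rw [Real.norm_eq_abs, abs_mul, abs_two, abs_mul]
    have hdet : |fderiv ℝ V x (EuclideanSpace.single (0 : Fin 3) (1 : ℝ)) 0 * fderiv ℝ V x (EuclideanSpace.single (1 : Fin 3) (1 : ℝ)) 1 - fderiv ℝ V x (EuclideanSpace.single (1 : Fin 3) (1 : ℝ)) 0 * fderiv ℝ V x (EuclideanSpace.single (0 : Fin 3) (1 : ℝ)) 1| ≤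
        2 * ‖fderiv ℝ V x‖ ^ 2 := by
      refine (abs_sub _ _).trans ?_
      rw [abs_mul, abs_mul]
      nlinarith [bb x 0 0, bb x 1 1, bb x 1 0, bb x 0 1, abs_nonneg (fderiv ℝ V x (EuclideanSpace.single (0 : Fin 3) (1 : ℝ)) 0), abs_nonneg (fderiv ℝ V x (EuclideanSpace.single (1 : Fin 3) (1 : ℝ)) 0),
        abs_nonneg (fderiv ℝ V x (EuclideanSpace.single (1 : Fin 3) (1 : ℝ)) 1), abs_nonneg (fderiv ℝ V x (EuclideanSpace.single (0 : Fin 3) (1 : ℝ)) 1)]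
    calc 2 * (|w (x 2)| * |fderiv ℝ V x (EuclideanSpace.single (0 : Fin 3) (1 : ℝ)) 0 * fderiv ℝ V x (EuclideanSpace.single (1 : Fin 3) (1 : ℝ)) 1 - fderiv ℝ V x (EuclideanSpace.single (1 : Fin 3) (1 : ℝ)) 0 * fderiv ℝ V x (EuclideanSpace.single (0 : Fin 3) (1 : ℝ)) 1|)
        ≤ 2 * (K * (2 * ‖fderiv ℝ V x‖ ^ 2)) :=
          mul_le_mul_of_nonneg_left (mul_le_mul (hwK _) hdet (abs_nonneg _) hK0) zero_le_two
      _ = 2 * (K * 2) * ‖fderiv ℝ V x‖ ^ 2 := by ring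
  rw [integral_congr_ae (Eventually.of_forall hpt), integral_add iAB idetI, integral_sub isum i22, integral_const_mul, idet, mul_zero,
    add_zero]

end ExtremiserLiouville

end Summit.NavierStokesRegularity.NavierStokesRegularity.Theorems

end
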